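import Summits.Ventures.HodgeRepro.SingleClass

/-!
# No census face is single-class — for EVERY finite `(G, c)` with `|G| ≥ 6`

Blind re-derivation cell `pub-hodge-repro`, seat `p1` (gen 6).  Continues typer's `SingleClass.lean`
(degrees 6, 8 by `decide`) and `SingleClass12*.lean` (degree 12): «the four corners of a face
`(Φ; π, π′)` never all lie in one right-translation class» — so the reduced product of a census face
(Lemma R, ROUTE.md §3.1–§3.5) has at least two non-isogenous simple factors — is here a THEOREM for
every finite group `G` with a complex conjugation `c` and `|G| ≥ 6` (`not_isSingleClass_faceCorners`).

Proof.  Write `Φ h` for the twist `rmul Φ h`, `π_p = {p, c p}`.  Since `c • Φ = Φ c`, the face is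
single-class iff there are `u, v, w` with `Φ ∆ Φ u = π_p`, `Φ ∆ Φ v = π_{p′}`, `Φ ∆ Φ w = π_p ∆ π_{p′}`.
**Lemma A** (`exists_pow_eq_conj` … `mem_iff_lt`): a twist `u` with `Φ ∆ Φ u` a SINGLE place generates
`G`, `c = u^m` (`|G| = 2m`) and `Φ = {p u^k : k < m}` up to complement — membership in `Φ` is unchanged
by `x ↦ x u⁻¹` except on `π_p`, so along the cycle of `p` it changes exactly at `p` and `c p` (hence
`c ∈ ⟨u⟩`), and a cycle missing `π_p` would carry constant membership although it contains `x` and `c x`.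
**Lemma C** (`eq_or_eq_inv_of_symmDiff_eq_place`): the only one-place twists are `u, u⁻¹` (for
`b = u^t`, `2 ≤ t ≤ m` puts `p, p u` in `Φ ∆ Φ b`, `m < t ≤ 2m − 2` puts `p u^{m−1}, p u^{m−2}` there —
two elements of `Φ` in one place).  **Theorem**: `v = u⁻¹`; the cocycle `Φ ∆ Φ (b a) = (Φ ∆ Φ a) ∆
(Φ ∆ Φ b) a` makes `w u⁻¹`, `w u` one-place twists, so `w = u⁻²` and `u⁻³ ∈ {u, u⁻¹}`: `2m ∣ 4`.
The bound is sharp: for `|G| = 4` the face IS single-class (`C₄`, `Φ = {0, 1}`).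
-/

set_option autoImplicit false

open Finset
open scoped Pointwise symmDiff

namespace HodgeRepro

variable {G : Type*} [Group G] [DecidableEq G]

/-- `{p, c p} · g = {p g, c (p g)}`: the right translate of a place is a place. -/
theorem rmul_place (c p g : G) : rmul (place c p) g = place c (p * g) := by
  ext x
  simp only [mem_rmul, mem_place, mul_inv_eq_iff_eq_mul, mul_assoc]

/-- Right translation distributes over symmetric differences. -/
theorem rmul_symmDiff (S T : Finset G) (g : G) : rmul (S ∆ T) g = rmul S g ∆ rmul T g := by
  ext x
  simp only [mem_rmul, Finset.mem_symmDiff]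

/-- For a central involution `c`, the conjugate type `c • Φ` is the twist `Φ c`. -/
theorem smul_eq_rmul_conj {c : G} (hc : IsComplexConj c) (Φ : Finset G) : c • Φ = rmul Φ c := by
  ext x
  rw [hc.mem_smul_iff, mem_rmul, hc.inv_eq, hc.comm]

/-- A place is conjugation-stable: `c • {p, c p} = {p, c p}`. -/
theorem smul_place {c : G} (hc : IsComplexConj c) (p : G) : c • place c p = place c p := by
  ext x
  rw [hc.mem_smul_iff, conj_mem_place_iff hc]

/-- Flipping the conjugate type is the conjugate of the flipped type. -/
theorem flipAt_smul_conj {c : G} (hc : IsComplexConj c) (p : G) (Φ : Finset G) :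
    flipAt c p (c • Φ) = c • flipAt c p Φ := by
  unfold flipAt
  rw [Finset.smul_finset_symmDiff, smul_place hc]

/-- Two embeddings of one place lie in each other's place. -/
theorem mem_place_of_mem_of_mem {c : G} (hc : IsComplexConj c) {s x y : G} (hx : x ∈ place c s)
    (hy : y ∈ place c s) : y ∈ place c x := by
  rw [mem_place] at hx hy ⊢
  rcases hx with rfl | rfl <;> rcases hy with rfl | rfl
  · exact Or.inl rfl
  · exact Or.inr rfl
  · right; rw [hc.mul_mul_cancel]
  · exact Or.inl rfl

omit [DecidableEq G] in
/-- `(u^k)⁻¹` is a power of `u` in a finite group: `(u^k)⁻¹ = u^{k (ord u − 1)}`. -/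
theorem inv_pow_eq_pow_mul [Fintype G] (u : G) (k : ℕ) :
    (u ^ k)⁻¹ = u ^ (k * (orderOf u - 1)) := by
  apply inv_eq_of_mul_eq_one_right
  obtain ⟨n', hn'⟩ : ∃ n', orderOf u = n' + 1 := ⟨orderOf u - 1, by have := orderOf_pos u; omega⟩
  rw [← pow_add, hn', Nat.add_sub_cancel, show k + k * n' = (n' + 1) * k by ring, pow_mul, ← hn',
    pow_orderOf_eq_one, one_pow]

/-- The one-place condition pointwise: `x ∈ {p, c p}` iff exactly one of `x ∈ Φ`, `x u⁻¹ ∈ Φ`. -/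
theorem mem_place_iff_of_symmDiff_eq {c p u : G} {Φ : Finset G} (hu : Φ ∆ rmul Φ u = place c p)
    (x : G) : x ∈ place c p ↔ ¬ (x ∈ Φ ↔ x * u⁻¹ ∈ Φ) := by
  rw [← hu, Finset.mem_symmDiff, mem_rmul]
  tauto

section OnePlace

variable [Fintype G] {c : G} {Φ : Finset G} {p u : G}

/-- Lemma A (i): `c` is a power of `u`.  Along the cycle `p, p u, p u², …` membership in `Φ` changes
exactly when leaving the place `{p, c p}`; if `c p` were not on the cycle it would change an odd
number of times per period. -/
theorem exists_pow_eq_conj (hc : IsComplexConj c) (hu : Φ ∆ rmul Φ u = place c p) :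
    ∃ j : ℕ, u ^ j = c := by
  by_contra hne
  push Not at hne
  have hpos : 0 < orderOf u := orderOf_pos u
  -- below the order, the walk never returns to the place
  have hstep : ∀ k : ℕ, k + 1 < orderOf u → (p * u ^ (k + 1) ∈ Φ ↔ p * u ^ k ∈ Φ) := by
    intro k hk
    have hnot : p * u ^ (k + 1) ∉ place c p := by
      rw [mem_place]
      rintro (h | h)
      · have h1 : u ^ (k + 1) = 1 := by
          have := h; rwa [mul_eq_left] at this
        have := Nat.le_of_dvd (Nat.succ_pos k) (orderOf_dvd_iff_pow_eq_one.2 h1)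
        omega
      · rw [hc.comm] at h
        exact hne (k + 1) (mul_left_cancel h)
    have e : p * u ^ (k + 1) * u⁻¹ = p * u ^ k := by
      rw [pow_succ, ← mul_assoc, mul_inv_cancel_right]
    have := mem_place_iff_of_symmDiff_eq hu (p * u ^ (k + 1))
    rw [e] at this
    tauto
  have hall : ∀ k : ℕ, k < orderOf u → (p * u ^ k ∈ Φ ↔ p ∈ Φ) := by
    intro k
    induction k with
    | zero => intro _; simp
    | succ k ih => intro hk; rw [hstep k hk, ih (by omega)]
  -- the return to `p` itself flips the parity
  have hp := mem_place_iff_of_symmDiff_eq hu p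
  have hpu : p * u⁻¹ = p * u ^ (orderOf u - 1) := by
    congr 1
    apply inv_eq_of_mul_eq_one_right
    rw [← pow_succ', Nat.sub_add_cancel hpos, pow_orderOf_eq_one]
  rw [hpu, hall _ (by omega)] at hp
  exact (hp.1 (mem_place_self c p)) Iff.rfl

/-- Lemma A (ii): every element of `G` lies on the cycle of `p`: `G = p ⟨u⟩`.  A cycle missing the
place `{p, c p}` would carry constant membership, yet it contains `x` and `c x = x c`. -/
theorem exists_eq_mul_pow (hc : IsComplexConj c) (hΦ : IsCMType c Φ)
    (hu : Φ ∆ rmul Φ u = place c p) (x : G) : ∃ k : ℕ, x = p * u ^ k := by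
  by_contra hne
  push Not at hne
  obtain ⟨j, hj⟩ := exists_pow_eq_conj hc hu
  have hnot : ∀ k : ℕ, x * u ^ k ∉ place c p := by
    intro k hk
    rw [mem_place] at hk
    rcases hk with h | h
    · apply hne (k * (orderOf u - 1))
      rw [← inv_pow_eq_pow_mul, ← h, mul_inv_cancel_right]
    · apply hne (j + k * (orderOf u - 1))
      rw [pow_add, ← inv_pow_eq_pow_mul, ← mul_assoc, hj, ← hc.comm, ← h, mul_inv_cancel_right]
  have hconst : ∀ k : ℕ, x * u ^ k ∈ Φ ↔ x ∈ Φ := by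
    intro k
    induction k with
    | zero => simp
    | succ k ih =>
      have e : x * u ^ (k + 1) * u⁻¹ = x * u ^ k := by
        rw [pow_succ, ← mul_assoc, mul_inv_cancel_right]
      have := mem_place_iff_of_symmDiff_eq hu (x * u ^ (k + 1))
      rw [e] at this
      have h2 := hnot (k + 1)
      rw [← ih]
      tauto
  have := hconst j
  rw [hj, ← hc.comm, hΦ.conj_mem_iff] at this
  exact iff_not_self this.symm

/-- Every element of `G` is a power of `u`. -/
theorem exists_pow_eq (hc : IsComplexConj c) (hΦ : IsCMType c Φ)
    (hu : Φ ∆ rmul Φ u = place c p) (x : G) : ∃ k : ℕ, u ^ k = x := by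
  obtain ⟨k₀, hk₀⟩ := exists_eq_mul_pow hc hΦ hu 1
  obtain ⟨k, hk⟩ := exists_eq_mul_pow hc hΦ hu x
  refine ⟨k₀ * (orderOf u - 1) + k, ?_⟩
  rw [pow_add, ← inv_pow_eq_pow_mul, hk]
  congr 1
  exact (eq_inv_of_mul_eq_one_left hk₀.symm).symm

/-- `u` generates `G`: its order is `|G|`. -/
theorem orderOf_eq_card (hc : IsComplexConj c) (hΦ : IsCMType c Φ)
    (hu : Φ ∆ rmul Φ u = place c p) : orderOf u = Fintype.card G := by
  rw [← Nat.card_eq_fintype_card]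
  apply orderOf_eq_card_of_forall_mem_zpowers
  intro x
  obtain ⟨k, rfl⟩ := exists_pow_eq hc hΦ hu x
  exact Subgroup.pow_mem _ (Subgroup.mem_zpowers u) k

/-- `c = u^m` where `|G| = 2m = 2 |Φ|`. -/
theorem pow_card_eq_conj (hc : IsComplexConj c) (hΦ : IsCMType c Φ)
    (hu : Φ ∆ rmul Φ u = place c p) : u ^ Φ.card = c := by
  obtain ⟨j, hj⟩ := exists_pow_eq_conj hc hu
  have hord : orderOf u = 2 * Φ.card := by rw [orderOf_eq_card hc hΦ hu, ← hΦ.two_mul_card hc]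
  have hdvd : 2 * Φ.card ∣ 2 * j := by
    rw [← hord, orderOf_dvd_iff_pow_eq_one, pow_mul', hj, sq, hc.mul_self]
  obtain ⟨q, hq⟩ := Nat.dvd_of_mul_dvd_mul_left (by norm_num) hdvd
  have hmod : j % (2 * Φ.card) = Φ.card * (q % 2) := by
    rw [hq, mul_comm 2 Φ.card, Nat.mul_mod_mul_left]
  rcases Nat.mod_two_eq_zero_or_one q with h2 | h2
  · exfalso
    apply hc.ne_one
    rw [← hj, ← pow_mod_orderOf u j, hord, hmod, h2, mul_zero, pow_zero]
  · rw [← hj, ← pow_mod_orderOf u j, hord, hmod, h2, mul_one]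

/-- Lemma A (iii), the block structure: `p u^k ∈ Φ ↔ p ∈ Φ` for `k < m` and `↔ p ∉ Φ` for
`m ≤ k < 2m`, i.e. `p u^k ∈ Φ ↔ (p ∈ Φ ↔ k mod 2m < m)`. -/
theorem mem_iff_lt (hc : IsComplexConj c) (hΦ : IsCMType c Φ) (hu : Φ ∆ rmul Φ u = place c p)
    (k : ℕ) : p * u ^ k ∈ Φ ↔ (p ∈ Φ ↔ k % (2 * Φ.card) < Φ.card) := by
  have hord : orderOf u = 2 * Φ.card := by rw [orderOf_eq_card hc hΦ hu, ← hΦ.two_mul_card hc]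
  have hcm : u ^ Φ.card = c := pow_card_eq_conj hc hΦ hu
  have hmpos : 0 < Φ.card := by
    rcases hΦ.mem_or_conj_mem 1 with h | h
    · exact Finset.card_pos.2 ⟨_, h⟩
    · exact Finset.card_pos.2 ⟨_, h⟩
  -- the first half-period
  have hlow : ∀ k : ℕ, k < Φ.card → (p * u ^ k ∈ Φ ↔ p ∈ Φ) := by
    intro k
    induction k with
    | zero => intro _; simp
    | succ k ih =>
      intro hk
      have hnot : p * u ^ (k + 1) ∉ place c p := by
        rw [mem_place]
        rintro (h | h)
        · have h1 : u ^ (k + 1) = 1 := by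
            have := h; rwa [mul_eq_left] at this
          have := Nat.le_of_dvd (Nat.succ_pos k) (orderOf_dvd_iff_pow_eq_one.2 h1)
          omega
        · rw [hc.comm, ← hcm] at h
          have h1 : u ^ (k + 1) = u ^ Φ.card := mul_left_cancel h
          rw [pow_inj_mod, hord, Nat.mod_eq_of_lt (by omega), Nat.mod_eq_of_lt (by omega)] at h1
          omega
      have e : p * u ^ (k + 1) * u⁻¹ = p * u ^ k := by
        rw [pow_succ, ← mul_assoc, mul_inv_cancel_right]
      have := mem_place_iff_of_symmDiff_eq hu (p * u ^ (k + 1))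
      rw [e] at this
      rw [← ih (by omega)]
      tauto
  -- the second half-period
  have hhigh : ∀ k : ℕ, Φ.card ≤ k → k < 2 * Φ.card → (p * u ^ k ∈ Φ ↔ p ∉ Φ) := by
    intro k hk1 hk2
    obtain ⟨k', rfl⟩ := Nat.exists_eq_add_of_le hk1
    rw [pow_add, hcm, ← mul_assoc, ← hc.comm, mul_assoc, hΦ.conj_mem_iff, hlow k' (by omega)]
  -- reduce the exponent modulo the order
  have hred : p * u ^ k = p * u ^ (k % (2 * Φ.card)) := by rw [← hord, pow_mod_orderOf]
  have hlt : k % (2 * Φ.card) < 2 * Φ.card := Nat.mod_lt _ (by omega)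
  rw [hred]
  by_cases h : k % (2 * Φ.card) < Φ.card
  · rw [hlow _ h]; tauto
  · rw [hhigh _ (by omega) hlt]; tauto

/-- **Lemma C**: the only twists moving the block `Φ` by a single place are `u` and `u⁻¹`
(`|G| = 2m ≥ 6`). -/
theorem eq_or_eq_inv_of_symmDiff_eq_place (hc : IsComplexConj c) (hΦ : IsCMType c Φ)
    (hu : Φ ∆ rmul Φ u = place c p) (h3 : 3 ≤ Φ.card) {b s : G}
    (hb : Φ ∆ rmul Φ b = place c s) : b = u ∨ b = u⁻¹ := by
  have hord : orderOf u = 2 * Φ.card := by rw [orderOf_eq_card hc hΦ hu, ← hΦ.two_mul_card hc]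
  have hcm : u ^ Φ.card = c := pow_card_eq_conj hc hΦ hu
  -- two distinct elements of `Φ` cannot lie in one place
  have htwo : ∀ k k' : ℕ, k < Φ.card → k' < Φ.card → k ≠ k' →
      p * u ^ k ∈ place c s → p * u ^ k' ∈ place c s → False := by
    intro k k' hk hk' hne h1 h2
    have := mem_place_of_mem_of_mem hc h1 h2
    rw [mem_place] at this
    rcases this with h | h
    · have h' : u ^ k' = u ^ k := mul_left_cancel h
      rw [pow_inj_mod, hord, Nat.mod_eq_of_lt (by omega), Nat.mod_eq_of_lt (by omega)] at h'
      omega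
    · rw [hc.comm, ← hcm, mul_assoc, ← pow_add] at h
      have h' : u ^ k' = u ^ (k + Φ.card) := mul_left_cancel h
      rw [pow_inj_mod, hord, Nat.mod_eq_of_lt (by omega), Nat.mod_eq_of_lt (by omega)] at h'
      omega
  -- `b` is a power `u^t` with `t < 2m`
  obtain ⟨j, rfl⟩ := exists_pow_eq hc hΦ hu b
  have hbt : u ^ j = u ^ (j % (2 * Φ.card)) := by rw [← hord, pow_mod_orderOf]
  rw [hbt] at hb ⊢
  have htlt : j % (2 * Φ.card) < 2 * Φ.card := Nat.mod_lt _ (by omega)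
  generalize j % (2 * Φ.card) = t at hb htlt ⊢
  -- `(u^t)⁻¹ = u^(2m - t)`
  have hinv : (u ^ t)⁻¹ = u ^ (2 * Φ.card - t) := by
    apply inv_eq_of_mul_eq_one_right
    rw [← pow_add, Nat.add_sub_of_le htlt.le, ← hord, pow_orderOf_eq_one]
  -- membership of `p u^k` in the place `{s, c s}`, in terms of exponents
  have hmemD : ∀ k : ℕ, p * u ^ k ∈ place c s ↔
      ¬ ((k % (2 * Φ.card) < Φ.card) ↔ ((k + (2 * Φ.card - t)) % (2 * Φ.card) < Φ.card)) := by
    intro k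
    rw [mem_place_iff_of_symmDiff_eq hb, hinv, mul_assoc, ← pow_add, mem_iff_lt hc hΦ hu,
      mem_iff_lt hc hΦ hu]
    tauto
  -- case analysis on `t`
  rcases Nat.lt_or_ge t 2 with ht2 | ht2
  · interval_cases t
    · -- `t = 0`: the twist is trivial, but `s ∈ Φ ∆ Φ`
      exfalso
      rw [pow_zero, rmul_one, symmDiff_self] at hb
      have := mem_place_self c s
      rw [← hb] at this
      simp at this
    · exact Or.inl (pow_one u)
  rcases Nat.lt_or_ge t (Φ.card + 1) with htm | htm
  · -- `2 ≤ t ≤ m`: `p` and `p u` both lie in the place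
    exfalso
    apply htwo 0 1 (by omega) (by omega) (by omega)
    · rw [hmemD, Nat.zero_mod, zero_add, Nat.mod_eq_of_lt (by omega)]
      omega
    · rw [hmemD, Nat.mod_eq_of_lt (by omega), Nat.mod_eq_of_lt (by omega)]
      omega
  rcases Nat.lt_or_ge t (2 * Φ.card - 1) with htm2 | htm2
  · -- `m + 1 ≤ t ≤ 2m − 2`: `p u^{m−1}` and `p u^{m−2}` both lie in the place
    exfalso
    apply htwo (Φ.card - 1) (Φ.card - 2) (by omega) (by omega) (by omega)
    · rw [hmemD, Nat.mod_eq_of_lt (by omega), Nat.mod_eq_of_lt (by omega)]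
      omega
    · rw [hmemD, Nat.mod_eq_of_lt (by omega), Nat.mod_eq_of_lt (by omega)]
      omega
  · -- `t = 2m − 1`: the twist is `u⁻¹`
    right
    have ht' : t = 2 * Φ.card - 1 := by omega
    rw [ht']
    apply eq_inv_of_mul_eq_one_left
    rw [← pow_succ, Nat.sub_add_cancel (by omega), ← hord, pow_orderOf_eq_one]

end OnePlace

/-- The cocycle identity for twists: `Φ ∆ Φ (b a) = (Φ ∆ Φ a) ∆ (Φ ∆ Φ b) a`. -/
theorem symmDiff_rmul_mul (Φ : Finset G) (a b : G) :
    Φ ∆ rmul Φ (b * a) = (Φ ∆ rmul Φ a) ∆ rmul (Φ ∆ rmul Φ b) a := by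
  rw [rmul_symmDiff, rmul_rmul, symmDiff_assoc, symmDiff_symmDiff_cancel_left]

/-- **No census face is single-class**, for every finite group `G` with a complex conjugation `c`
and `|G| ≥ 6`: for every CM type `Φ` and every two distinct places, the corners
`Φ, (c • Φ)^{(p)}, (c • Φ)^{(p′)}, Φ^{(p p′)}` are not all right translates of `Φ`. -/
theorem not_isSingleClass_faceCorners [Fintype G] {c : G} (hc : IsComplexConj c) {Φ : Finset G}
    (hΦ : IsCMType c Φ) {p p' : G} (hp : p' ∉ place c p) (h6 : 6 ≤ Fintype.card G) :
    ¬ IsSingleClass (faceCorners c Φ p p') := by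
  intro hs
  obtain ⟨g₁, h1⟩ := hs 1
  obtain ⟨g₂, h2⟩ := hs 2
  obtain ⟨w, h3⟩ := hs 3
  have h1' : flipAt c p (c • Φ) = rmul Φ g₁ := h1
  have h2' : flipAt c p' (c • Φ) = rmul Φ g₂ := h2
  have h3' : flipAt c p' (flipAt c p Φ) = rmul Φ w := h3
  have h3m : 3 ≤ Φ.card := by have := hΦ.two_mul_card hc; omega
  -- the three twists `u, v, w` and the one-place / two-place equations
  have key : ∀ q g : G, flipAt c q (c • Φ) = rmul Φ g → Φ ∆ rmul Φ (c * g) = place c q := by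
    intro q g h
    rw [flipAt_smul_conj hc] at h
    have h' : flipAt c q Φ = rmul Φ (c * g) := by
      rw [← rmul_rmul, ← smul_eq_rmul_conj hc, ← smul_rmul, ← h, hc.smul_smul_finset]
    unfold flipAt at h'
    rw [← h', symmDiff_symmDiff_cancel_left]
  have hu := key p g₁ h1'
  have hv := key p' g₂ h2'
  have hw : Φ ∆ rmul Φ w = place c p ∆ place c p' := by
    unfold flipAt at h3'
    rw [← h3', ← symmDiff_assoc, symmDiff_symmDiff_cancel_left]
  set u := c * g₁ with hu_def
  set v := c * g₂ with hv_def
  -- `v ∈ {u, u⁻¹}`, and `v ≠ u` since the places differ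
  have hvu : v = u⁻¹ := by
    rcases eq_or_eq_inv_of_symmDiff_eq_place hc hΦ hu h3m hv with h | h
    · exfalso
      rw [h, hu] at hv
      have := mem_place_self c p'
      rw [← hv] at this
      exact hp this
    · exact h
  -- `Φ ∆ Φ (w u⁻¹)` and `Φ ∆ Φ (w v⁻¹)` are single places
  have hwu : Φ ∆ rmul Φ (w * u⁻¹) = place c (p' * u⁻¹) := by
    have hinv : Φ ∆ rmul Φ u⁻¹ = rmul (place c p) u⁻¹ := by
      rw [← hu, rmul_symmDiff, rmul_rmul, mul_inv_cancel, rmul_one, symmDiff_comm]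
    rw [symmDiff_rmul_mul, hinv, hw, rmul_symmDiff, rmul_place, rmul_place,
      symmDiff_symmDiff_cancel_left]
  have hwv : Φ ∆ rmul Φ (w * v⁻¹) = place c (p * v⁻¹) := by
    have hinv : Φ ∆ rmul Φ v⁻¹ = rmul (place c p') v⁻¹ := by
      rw [← hv, rmul_symmDiff, rmul_rmul, mul_inv_cancel, rmul_one, symmDiff_comm]
    rw [symmDiff_rmul_mul, hinv, hw, rmul_symmDiff, rmul_place, rmul_place,
      symmDiff_comm (a := place c (p * v⁻¹)), symmDiff_symmDiff_cancel_left]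
  have hA := eq_or_eq_inv_of_symmDiff_eq_place hc hΦ hu h3m hwu
  have hB := eq_or_eq_inv_of_symmDiff_eq_place hc hΦ hu h3m hwv
  rw [hvu, inv_inv] at hB
  -- `w = 1` is excluded: the two places would coincide
  have hw1 : w ≠ 1 := by
    intro h
    rw [h, rmul_one, symmDiff_self, eq_comm, symmDiff_eq_bot] at hw
    have := mem_place_self c p'
    rw [← hw] at this
    exact hp this
  -- hence `w = u⁻²` and `u⁻³ ∈ {u, u⁻¹}`: the order of `u` divides `4`
  have hw2 : w = u⁻¹ * u⁻¹ := by
    rcases hB with h | h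
    · exact absurd (mul_right_cancel (h.trans (one_mul u).symm)) hw1
    · rw [eq_mul_inv_iff_mul_eq, h]
  have hord : orderOf u = Fintype.card G := orderOf_eq_card hc hΦ hu
  have hdvd : orderOf u ∣ 4 := by
    rw [orderOf_dvd_iff_pow_eq_one]
    rcases hA with h | h
    · rw [hw2] at h
      have e : u ^ 3 * (u⁻¹ * u⁻¹ * u⁻¹) = u ^ 3 * u := by rw [h]
      rw [show u ^ 3 * (u⁻¹ * u⁻¹ * u⁻¹) = 1 by group, show u ^ 3 * u = u ^ 4 by group] at e
      exact e.symm
    · rw [hw2] at h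
      have e : u ^ 3 * (u⁻¹ * u⁻¹ * u⁻¹) = u ^ 3 * u⁻¹ := by rw [h]
      rw [show u ^ 3 * (u⁻¹ * u⁻¹ * u⁻¹) = 1 by group, show u ^ 3 * u⁻¹ = u ^ 2 by group] at e
      rw [show u ^ 4 = u ^ 2 * u ^ 2 by group, ← e, one_mul]
  have := Nat.le_of_dvd (by norm_num) hdvd
  omega

end HodgeRepro
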